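import Literature.NumberTheory.EllipticCurves.LocalPointsModKernelOfReductionMultiplicativeProofs
import Literature.NumberTheory.EllipticCurves.KodairaNeronUnramifiedInertiaProofs
import Literature.NumberTheory.EllipticCurves.TateCurve.MultiplicativeTwistUnramifiedProofs
import Literature.NumberTheory.EllipticCurves.PastenHeightBoundsLemma68LocalProofs
import Literature.NumberTheory.EllipticCurves.OpenImageMazurTwistProofs
import Literature.NumberTheory.EllipticCurves.OpenImageMazurCharacterProofs
import Literature.NumberTheory.EllipticCurves.OpenImageMazurGoodAtNProofs
import Literature.NumberTheory.EllipticCurves.OpenImageMazurInertiaProofs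
import Literature.NumberTheory.EllipticCurves.OpenImageMazurInertiaThreeProofs
import Literature.NumberTheory.EllipticCurves.CyclicIsogenyCharacterFrobeniusProofs
import Literature.NumberTheory.EllipticCurves.GaloisActionProofs
import Literature.NumberTheory.EllipticCurves.RationalIsogenyDegreesProofs
import Literature.NumberTheory.EllipticCurves.RationalIsogenyFrobeniusCriterionPrimePower
import Literature.NumberTheory.EllipticCurves.OpenImageMazurNumericsProofs
import Literature.NumberTheory.EllipticCurves.HeegnerPointsKolyvaginPrimaryCongruenceProofs
import Literature.NumberTheory.EllipticCurves.IsogenyVariableChangeProofs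
import Literature.NumberTheory.EllipticCurves.IsogenyCompProofs
import Literature.NumberTheory.EllipticCurves.GlobalMinimalModelProofs
import Literature.NumberTheory.EllipticCurves.SzpiroFreyCurveProofs
import Literature.NumberTheory.EllipticCurves.SzpiroOfAbcProofs
import Literature.NumberTheory.EllipticCurves.NoConductorOne
import Literature.NumberTheory.EllipticCurves.PastenValuationProductThm75MultiplicityProofs
import Literature.NumberTheory.EllipticCurves.SupersingularDensitySerreFrobeniusProofs
import Literature.NumberTheory.EllipticCurves.RankinSelbergEulerProductGaloisProofs
import Literature.NumberTheory.DiophantineGeometry.GeneralizedFermatTwoPowerCoefficientSerreWeightProofs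
import Literature.NumberTheory.DiophantineGeometry.LocalReductionProofs
import Literature.NumberTheory.DiophantineGeometry.Conductor
import Literature.NumberTheory.EllipticCurves.OrdinaryReductionTorsionCharactersProofs
import Literature.NumberTheory.EllipticCurves.OrdinaryReductionUnramifiedCharacterProofs
import Literature.NumberTheory.EllipticCurves.TateCurve.NumberFieldUniformizationTwistedKernelOfReductionIff
import Literature.NumberTheory.EllipticCurves.SelmerCorankControlRatProofs
import Literature.NumberTheory.EllipticCurves.IsogenyFrobeniusTraceProofs
import Literature.NumberTheory.GaloisRepresentations.DecompositionGroupOfCompletion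
import Literature.NumberTheory.GaloisRepresentations.RamificationFiltrationProofs
import Literature.NumberTheory.GaloisRepresentations.TateLevelOneWildOdd
import Literature.NumberTheory.Automorphic.AdicCompletionLocalField
import Literature.NumberTheory.GaloisRepresentations.ModNCyclotomicCharacter
import Literature.NumberTheory.EllipticCurves.TakahashiDegreeFormulaCoprimeProofs
import Literature.NumberTheory.EllipticCurves.PastenSpectralDegree
import Literature.NumberTheory.EllipticCurves.PastenHeightBounds
import Literature.NumberTheory.EllipticCurves.PastenSpectralDegreeIsogenyBoundProofs
import Literature.NumberTheory.EllipticCurves.IsogenyDegreeLatticeIndexProofs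
import Literature.NumberTheory.EllipticCurves.ModularCurveManinSemistableBridgeProofs
import Literature.NumberTheory.EllipticCurves.ModularDegreeMinimal
import Literature.NumberTheory.EllipticCurves.IsogenyDualProofs
import Literature.NumberTheory.EllipticCurves.IsogenyIdProofs
import Literature.NumberTheory.Automorphic.ShimuraCurveRibetTakahashiComponentOrders
import Literature.NumberTheory.DiophantineGeometry.MinimalDiscriminantFactorizationProofs
import HarnessLib

/-!
# Route DefiniteXi, crux `DefiniteRTControlPrime` (stmt-ABC-11338) from Takahashi 2001 Thm 2.3 ALONE —
# part 1/7: the cyclic isogeny character, LOCAL analysis away from `ℓ`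

A cyclic `ℓᵏ`-isogeny (`ℓ` odd) out of a global minimal model `W/ℚ` gives a Galois-stable line `⟨P⟩`,
`|P| = ℓᵏ`, hence a character `r : Gal(ℚ̄/ℚ) → (ℤ/ℓᵏ)ˣ`.  This file: four unit-level pieces (α–δ) of the
local Tate-curve lemma at a multiplicative place `v ∣ ℓ` and its assembly `exists_multiplicativeContainer_local`
(D3loc), and the HALF-LEVEL lemma at a multiplicative place `v ∤ ℓ` (`1 < v(j)`): `r² ≡ 1 (mod ℓ^⌈k/2⌉)` on inertia
(`unitsMap_cyclicCharacter_sq_eq_one_of_one_lt_valuation_j`, the `ℓᵏ`-port of Mazur 1978 §5 / the tree's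
`Mazur1978.isogenyCharacter_sq_eq_one_of_one_lt_valuation_j`).  Parts 2–7:
`DefiniteXiDefiniteRTControlPrimeCyclicCharacterAtEll`, `…CyclicCharacterGlobal`, `…CyclicDegreeFrobNorm`, `…OfTakahashiLeaves`,
`…OfTakahashiGlue`, `…OfTakahashi` (final theorem `definiteRTControlPrime_of_takahashi :
takahashi2001_thm_2_3_of_coprime → DefiniteRTControlPrime`: neither Mazur–Kenku, nor Pasten's Lemma 6.8,
nor Pasten's `163·δ` bound is in the debt of the crux).

Origin: crux programme of stmt-ABC-11338, kernel certificate `Cruxes/DefiniteRTControlPrime/StubIdeasK2G11CruxFromTakahashi.lean` (stub-ideation k2, gens 2–11; farm `lean check` rc 0, 0 sorries, axioms propext/Classical.choice/Quot.sound), re-packaged verbatim into seven `≤ 400`-line modules by k2 gen 12 (namespaces `…Theorems.DefiniteRTControlPrime.CyclicCharacter` / `.OfTakahashi`; statements and proofs unchanged).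

## References

* [Mazur1978] B. Mazur, Rational isogenies of prime degree, Invent. Math. 44 (1978) 129–162, §5 (isogeny characters), Lemma 5.2–5.4.
* [Serre1972] J.-P. Serre, Propriétés galoisiennes des points d'ordre fini des courbes elliptiques, Invent. Math. 15 (1972), §1.11–1.12, §5.4 Prop. 21.
* [SilvermanATAEC1994] J. H. Silverman, Advanced Topics in the Arithmetic of Elliptic Curves, GTM 151, Thm. V.5.3, Cor. V.5.4, Prop. V.6.1 (Tate curve, Galois action).
* [Takahashi2001] S. Takahashi, Degrees of parametrizations of elliptic curves by Shimura curves, J. Number Theory 90 (2001) 74–88, Thm. 2.3 (p. 79).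
* [PastenShimura2024] H. Pasten, Shimura curves and the abc conjecture, J. Number Theory 254 (2024) 214–335 = arXiv:1705.09251, §3 p. 13, §6.4, Lemma 6.8.
-/

set_option linter.dupNamespace false

namespace Summit.ABC.ABC.Theorems.DefiniteRTControlPrime.CyclicCharacter

open Literature.NumberTheory.EllipticCurves Literature.NumberTheory.EllipticCurves.ModularForms
open Literature.NumberTheory.GaloisRepresentations Literature.NumberTheory.EllipticCurves.TateCurve
open WeierstrassCurve IsDedekindDomain IsDedekindDomain.HeightOneSpectrum NumberField Field
open scoped NumberField NNReal Classical

/-! ## §1 The four unit-level pieces of D3loc -/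

section Pieces

variable {K : Type} [Field K] [NumberField K] {v : HeightOneSpectrum (𝓞 K)}

/-- **α (XS, pure valuation algebra).**  A principal unit which is an `N`-division value of `q^ℤ` is an
`N`-th root of unity: the exponent of `q` vanishes. [folklore] -/
theorem zpow_exp_eq_zero_of_principal {L : Type*} [Field L] (w : Valuation L ℝ≥0) {u Q : L}
    (hu : w (u - 1) < 1) (hQ0 : Q ≠ 0) (hQ : w Q < 1) {N : ℕ} {n : ℤ} (h : u ^ N = Q ^ n) :
    n = 0 := by
  have hu1 : w u = 1 := by
    have h1 := Valuation.map_add_eq_of_lt_left w (x := (1 : L)) (y := u - 1)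
      (by rw [map_one]; exact hu)
    rwa [map_one, add_sub_cancel] at h1
  have hQn : w Q ^ n = w Q ^ (0 : ℤ) := by
    rw [zpow_zero, ← map_zpow₀, ← h, map_pow, hu1, one_pow]
  exact (zpow_right_strictAnti₀ ((Valuation.pos_iff _).mpr hQ0) hQ).injective hQn

/-- **β (XS).**  At a place `v ∣ ℓ`, every `ℓ`-power root of unity of `K̄_v` is a principal unit
(Frobenius is injective on `k̄_v`). [cite: SerreLocalFields1979, Ch. IV §4 Prop. 17] -/
theorem spectralValuation_sub_one_lt_one_of_pow_prime_pow_eq_one {ℓ : ℕ} [Fact ℓ.Prime]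
    (hℓv : ((ℓ : ℕ) : 𝓞 K) ∈ v.asIdeal) (k : ℕ) {ζ : AlgebraicClosure (v.adicCompletion K)}
    (hζ : ζ ^ ℓ ^ k = 1) : v.spectralValuation (ζ - 1) < 1 := by
  have h1 : v.spectralValuation ζ = 1 := by
    have h : v.spectralValuation ζ ^ ℓ ^ k = 1 := by rw [← map_pow, hζ, map_one]
    exact (pow_eq_one_iff_of_nonneg zero_le (pow_ne_zero _ (Fact.out : ℓ.Prime).ne_zero)).mp h
  exact WeierstrassCurve.spectralValuation_sub_one_lt_one_of_pow hℓv k h1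
    (by rw [hζ, sub_self, map_zero]; exact one_pos)

/-- **γ (XS).**  The twist sign of Tate's uniformisation is `+1` on the absolute inertia group of `K_v`:
`σ t = t` for `t² = γ(W) = −c₄/c₆` and `σ ∈ absInertia K_v`. [cite: SilvermanATAEC1994, Thm. V.5.3 (b)] -/
theorem toAlgEquiv_eq_of_mem_absInertia_of_sq_eq_gamma (W : WeierstrassCurve K) [W.IsElliptic]
    (hmult : W.HasMultiplicativeReductionAt v) {t : AlgebraicClosure (v.adicCompletion K)}
    (ht : t ^ 2 = algebraMap (v.adicCompletion K) (AlgebraicClosure (v.adicCompletion K))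
      (algebraMap K (v.adicCompletion K) (-(W.c₄ / W.c₆))))
    {σ : absoluteGaloisGroup (v.adicCompletion K)} (hσ : σ ∈ absInertia (v.adicCompletion K)) :
    absoluteGaloisGroup.toAlgEquiv (v.adicCompletion K) σ t = t := by
  obtain ⟨𝔐, h𝔐⟩ := v.localPrimesAbove_nonempty
  rw [← inertia_eq_absInertia (coe_spectralValuation v) h𝔐] at hσ
  exact toAlgEquiv_eq_of_mem_inertia_of_sq_eq_gamma W hmult h𝔐 ht hσ

/-- **δ (XS, pure algebra).**  The Kummer cocycle of an `N`-division value of `q^n` (`q ∈ K_v`) is an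
`N`-th root of unity: `(σw/w)^N = σ(q^n)/q^n = 1`. [folklore] -/
theorem units_map_div_pow_eq_one {q : v.adicCompletion K} (hq0 : q ≠ 0)
    (σ : absoluteGaloisGroup (v.adicCompletion K)) {w : (AlgebraicClosure (v.adicCompletion K))ˣ}
    {N : ℕ} {n : ℤ}
    (hw : ((w : AlgebraicClosure (v.adicCompletion K))) ^ N =
      algebraMap (v.adicCompletion K) (AlgebraicClosure (v.adicCompletion K)) q ^ n) :
    ((Units.map (absoluteGaloisGroup.toAlgEquiv (v.adicCompletion K) σ :
        AlgebraicClosure (v.adicCompletion K) →* AlgebraicClosure (v.adicCompletion K)) w / w :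
        (AlgebraicClosure (v.adicCompletion K))ˣ) : AlgebraicClosure (v.adicCompletion K)) ^ N = 1 := by
  have hq' : algebraMap (v.adicCompletion K) (AlgebraicClosure (v.adicCompletion K)) q ≠ 0 :=
    (map_ne_zero_iff _ (algebraMap (v.adicCompletion K) _).injective).2 hq0
  rw [Units.val_div_eq_div_val, Units.coe_map, MonoidHom.coe_coe, div_pow, ← map_pow, hw,
    map_zpow₀, AlgEquiv.commutes, div_self (zpow_ne_zero n hq')]

end Pieces

/-! ## §2 D3loc assembled (g10 signature verbatim) -/

/-- **D3loc (S; g10 signature verbatim; body = α β γ δ + bookkeeping through `Ψ`).**  At a multiplicative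
`v ∣ ℓ`: (i) inertia acts on the `ℓᵏ`-torsion of the kernel of reduction `E₁(ℚ̄_v) = Ψ(1 + 𝔪)` through
the local mod-`ℓᵏ` cyclotomic character; (ii) `σQ − Q ∈ E₁(ℚ̄_v)` for every `ℓᵏ`-torsion `Q` and inertial `σ`.
[cite: SilvermanATAEC1994, §V.4–V.5] -/
theorem exists_multiplicativeContainer_local (W : WeierstrassCurve ℚ) [W.IsElliptic]
    {v : HeightOneSpectrum (𝓞 ℚ)} (hv : W.HasMultiplicativeReductionAt v) {ℓ : ℕ} [Fact ℓ.Prime]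
    (hℓv : (ℓ : 𝓞 ℚ) ∈ v.asIdeal) (k : ℕ) [NeZero ((ℓ ^ k : ℕ) : v.adicCompletion ℚ)] :
    (∀ σ ∈ absInertia (v.adicCompletion ℚ), ∀ Q ∈ W.localKernelOfReduction v, ℓ ^ k • Q = 0 →
        σ • Q = ((modNCyclotomicCharacter (v.adicCompletion ℚ) (ℓ ^ k) σ : (ZMod (ℓ ^ k))ˣ) :
          ZMod (ℓ ^ k)).val • Q) ∧
      (∀ σ ∈ absInertia (v.adicCompletion ℚ), ∀ Q : localPoints W (v.adicCompletion ℚ),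
        ℓ ^ k • Q = 0 → σ • Q - Q ∈ W.localKernelOfReduction v) := by
  set L := AlgebraicClosure (v.adicCompletion ℚ) with hL
  obtain ⟨q, t, Ψ, hq0, hq1, -, ht, hsurj, hker, hΨσ, hiff⟩ :=
    exists_twistedTateUniformisation_localKernelOfReduction_iff W v hv
  have hw := coe_spectralValuation v
  set qL := algebraMap (v.adicCompletion ℚ) L q with hqL
  have hq' : qL ≠ 0 := (map_ne_zero_iff _ (algebraMap (v.adicCompletion ℚ) L).injective).2 hq0
  have hwq : v.spectralValuation qL < 1 := by
    rw [← NNReal.coe_lt_coe, hqL, coe_spectralValuation_algebraMap hw, NNReal.coe_one]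
    exact Valued.toNormedField.norm_lt_one_iff.mpr hq1
  -- γ: the sign is `+1` on inertia
  have hsign : ∀ σ ∈ absInertia (v.adicCompletion ℚ), ∀ u : Lˣ,
      σ • Ψ (Additive.ofMul u) =
        Ψ (Additive.ofMul (Units.map (absoluteGaloisGroup.toAlgEquiv (v.adicCompletion ℚ) σ :
          L →* L) u)) := by
    intro σ hσ u
    rw [hΨσ σ u, if_pos (toAlgEquiv_eq_of_mem_absInertia_of_sq_eq_gamma W hv ht hσ), one_zsmul]
  -- the exponent of `q` in `u^{ℓᵏ}` for `Ψ(u)` killed by `ℓᵏ`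
  have hroot : ∀ u : Lˣ, ℓ ^ k • Ψ (Additive.ofMul u) = 0 →
      ∃ n : ℤ, ((u : L)) ^ ℓ ^ k = qL ^ n := by
    intro u hu
    have h0 : Ψ (Additive.ofMul (u ^ ℓ ^ k)) = 0 := by rw [ofMul_pow, map_nsmul, hu]
    obtain ⟨n, hn⟩ := (hker _).mp h0
    exact ⟨n, by rw [← Units.val_pow_eq_pow_val, hn]⟩
  constructor
  · -- (i) `E₁[ℓᵏ] ⊆ Ψ(μ_{ℓᵏ})`, inertia acts by `χ`
    intro σ hσ Q hQ hQk
    obtain ⟨u, hu1, rfl⟩ := (hiff Q).mp hQ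
    obtain ⟨n, hn⟩ := hroot u hQk
    have hn0 : n = 0 := zpow_exp_eq_zero_of_principal v.spectralValuation hu1 hq' hwq hn
    have huN : (u : L) ^ ℓ ^ k = 1 := by rw [hn, hn0, zpow_zero]
    have hσu : absoluteGaloisGroup.toAlgEquiv (v.adicCompletion ℚ) σ (u : L) =
        (u : L) ^ ((modNCyclotomicCharacter (v.adicCompletion ℚ) (ℓ ^ k) σ : (ZMod (ℓ ^ k))ˣ) :
          ZMod (ℓ ^ k)).val :=
      modNCyclotomicCharacter_spec (v.adicCompletion ℚ) (ℓ ^ k) σ (u : L) huN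
    have hmap : Units.map (absoluteGaloisGroup.toAlgEquiv (v.adicCompletion ℚ) σ : L →* L) u =
        u ^ ((modNCyclotomicCharacter (v.adicCompletion ℚ) (ℓ ^ k) σ : (ZMod (ℓ ^ k))ˣ) :
          ZMod (ℓ ^ k)).val :=
      Units.ext (by rw [Units.coe_map, Units.val_pow_eq_pow_val]; exact hσu)
    rw [hsign σ hσ u, hmap, ofMul_pow, map_nsmul]
  · -- (ii) the Kummer cocycle lands in `Ψ(μ_{ℓ^∞}) ⊆ E₁`
    intro σ hσ Q hQk
    obtain ⟨a, rfl⟩ := hsurj Q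
    obtain ⟨w, rfl⟩ : ∃ w : Lˣ, Additive.ofMul w = a := ⟨Additive.toMul a, ofMul_toMul a⟩
    obtain ⟨n, hn⟩ := hroot w hQk
    rw [hsign σ hσ w, ← map_sub, ← ofMul_div]
    refine (hiff _).mpr ⟨_, ?_, rfl⟩
    exact spectralValuation_sub_one_lt_one_of_pow_prime_pow_eq_one hℓv k
      (units_map_div_pow_eq_one hq0 σ hn)


/-! ## §4 T2 at level `ℓᵏ` — the PORT of `Mazur1978.isogenyCharacter_sq_eq_one_of_one_lt_valuation_j`
(U1/U1k/Z1 copied verbatim from gen 10, where they are proved; T2 body = the port itself) -/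

/-- `⌈k/2⌉` (g3 verbatim). -/
def halfCeil (k : ℕ) : ℕ := (k + 1) / 2

/-- `⌈k/2⌉ ≤ k`. -/
theorem halfCeil_le (k : ℕ) : halfCeil k ≤ k := by unfold halfCeil; omega

/-- `ℓ^⌈k/2⌉ ∣ ℓᵏ`. -/
theorem pow_halfCeil_dvd (ℓ k : ℕ) : ℓ ^ halfCeil k ∣ ℓ ^ k := pow_dvd_pow ℓ (halfCeil_le k)

/-- U1 (g3/g10 verbatim). -/
theorem pow_halfCeil_dvd_of_sq_smul_eq_zero {M : Type*} [AddCommGroup M] {ℓ k : ℕ} (hℓ : ℓ.Prime)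
    {P : M} (hP : addOrderOf P = ℓ ^ k) {s : ℤ} (hs : ((s - 1) ^ 2) • P = 0) :
    (ℓ : ℤ) ^ halfCeil k ∣ s - 1 := by
  haveI := Fact.mk hℓ
  have h1 : ((ℓ : ℤ) ^ k) ∣ (s - 1) ^ 2 := by
    have := addOrderOf_dvd_iff_zsmul_eq_zero.mpr hs
    rw [hP] at this
    exact_mod_cast this
  rcases eq_or_ne (s - 1) 0 with h0 | h0
  · rw [h0]; exact dvd_zero _
  rw [padicValInt_dvd_iff] at h1 ⊢
  refine Or.inr ?_
  rcases h1 with h1 | h1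
  · exact absurd (pow_eq_zero_iff two_ne_zero |>.mp h1) h0
  · rw [pow_two, padicValInt.mul h0 h0] at h1
    unfold halfCeil
    omega

/-- U1k (g10 verbatim, proved). -/
theorem pow_halfCeil_dvd_sub_one_of_unipotent {A : Type*} [AddCommGroup A] {ℓ k : ℕ} (hℓ : ℓ.Prime)
    {Q : A} (hQ : addOrderOf Q = ℓ ^ k) (τ : A →+ A) {s : ℤ} (hs : τ Q = s • Q)
    (hunip : τ (τ Q - Q) = τ Q - Q) : (ℓ : ℤ) ^ halfCeil k ∣ s - 1 := by
  have h1 : ((s - 1) ^ 2) • Q = 0 := by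
    rw [map_sub, hs, map_zsmul, hs, smul_smul] at hunip
    have h2 : (s * s - s - (s - 1)) • Q = 0 := by
      rw [sub_smul, sub_smul, sub_smul, one_smul, hunip, sub_self]
    rw [show (s - 1) ^ 2 = s * s - s - (s - 1) by ring]
    exact h2
  exact pow_halfCeil_dvd_of_sq_smul_eq_zero hℓ hQ h1

/-- Z1 (g10 verbatim, proved). -/
theorem unitsMap_sq_eq_one_of_dvd_sub_one {ℓ k : ℕ} [NeZero (ℓ ^ k)] (r : (ZMod (ℓ ^ k))ˣ) {s : ℤ}
    (hsr : ((s : ℤ) : ZMod (ℓ ^ k)) = (r : ZMod (ℓ ^ k)) ∨ ((s : ℤ) : ZMod (ℓ ^ k)) = -(r : ZMod (ℓ ^ k)))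
    (hdiv : (ℓ : ℤ) ^ halfCeil k ∣ s - 1) :
    ZMod.unitsMap (pow_halfCeil_dvd ℓ k) r ^ 2 = 1 := by
  have hs1 : ((s : ℤ) : ZMod (ℓ ^ halfCeil k)) = 1 := by
    have h : (((s - 1 : ℤ)) : ZMod (ℓ ^ halfCeil k)) = 0 := by
      rw [ZMod.intCast_zmod_eq_zero_iff_dvd]; exact_mod_cast hdiv
    rwa [Int.cast_sub, Int.cast_one, sub_eq_zero] at h
  have hcast : ((ZMod.unitsMap (pow_halfCeil_dvd ℓ k) r : (ZMod (ℓ ^ halfCeil k))ˣ) :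
      ZMod (ℓ ^ halfCeil k)) = ZMod.castHom (pow_halfCeil_dvd ℓ k) (ZMod (ℓ ^ halfCeil k))
        (r : ZMod (ℓ ^ k)) := rfl
  apply Units.ext
  rw [Units.val_pow_eq_pow_val, Units.val_one, hcast]
  rcases hsr with h | h
  · rw [← h, map_intCast, hs1, one_pow]
  · rw [show (r : ZMod (ℓ ^ k)) = -((s : ℤ) : ZMod (ℓ ^ k)) by rw [h, neg_neg], map_neg, map_intCast,
      hs1, neg_one_sq]

/-- **T2 (the port, g10 signature verbatim).**  `v(j) < 0` at a place `v ∤ ℓ` ⇒ `r̄(τ)² = 1` on inertia at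
`v` at HALF level `ℓ^⌈k/2⌉`.  Line-by-line port of `Mazur1978.isogenyCharacter_sq_eq_one_of_one_lt_valuation_j`
(`N ↦ ℓᵏ`, `(n := 1) ↦ (n := k)`, `intCast_eq_one_of_unipotent ↦ U1k`, last step `↦ Z1`).
[cite: Mazur1978, §5 Prop. 5.1] [cite: SilvermanATAEC1994, V.5 Thm. 5.3] -/
theorem unitsMap_cyclicCharacter_sq_eq_one_of_one_lt_valuation_j (W : WeierstrassCurve ℚ)
    [W.IsElliptic] {v : HeightOneSpectrum (𝓞 ℚ)} (hj : 1 < v.valuation ℚ W.j)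
    {ℓ k : ℕ} [Fact ℓ.Prime] (hℓv : (ℓ : 𝓞 ℚ) ∉ v.asIdeal) (hk : 1 ≤ k)
    {P : geomPoints W} (hP : addOrderOf P = ℓ ^ k)
    {r : absoluteGaloisGroup ℚ →* (ZMod (ℓ ^ k))ˣ}
    (hr : ∀ σ : absoluteGaloisGroup ℚ, σ • P = ((r σ : (ZMod (ℓ ^ k))ˣ) : ZMod (ℓ ^ k)).val • P)
    {𝔓 : Ideal (absIntegers (𝓞 ℚ) ℚ)} (h𝔓 : 𝔓 ∈ v.primesAbove)
    {τ : absoluteGaloisGroup ℚ} (hτ : τ ∈ 𝔓.inertia (absoluteGaloisGroup ℚ)) :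
    ZMod.unitsMap (pow_halfCeil_dvd ℓ k) (r τ) ^ 2 = 1 := by
  have hℓ : ℓ.Prime := Fact.out
  haveI : NeZero (2 : ℚ) := ⟨two_ne_zero⟩
  haveI : NeZero (ℓ ^ k) := ⟨pow_ne_zero _ hℓ.ne_zero⟩
  -- a twist with multiplicative reduction at `v`
  obtain ⟨d, hd0, hmult⟩ :=
    W.exists_hasMultiplicativeReductionAt_quadraticTwist_of_one_lt_valuation_j v hj
  haveI := W.isElliptic_quadraticTwist hd0
  obtain ⟨f, hf⟩ := W.exists_addEquiv_geomPoints_quadraticTwist_signed hd0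
  -- transport `P` to the twist (order is preserved)
  have hNP : ℓ ^ k • P = 0 := by rw [← hP]; exact addOrderOf_nsmul_eq_zero P
  set Q : (W.quadraticTwist d).geomPoints := f.symm P with hQ
  have hfQ : f Q = P := f.apply_symm_apply _
  have hQN : ℓ ^ k • Q = 0 := by
    apply f.injective
    rw [map_nsmul, hfQ, map_zero, hNP]
  have hQord : addOrderOf Q = ℓ ^ k := by
    rw [← addOrderOf_injective f.toAddMonoidHom f.injective Q, AddEquiv.coe_toAddMonoidHom, hfQ, hP]
  -- unipotence of `τ` on `Q` at level `ℓᵏ` (the engine already takes `p ^ n`)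
  have hunip : τ • (τ • Q - Q) = τ • Q - Q :=
    (W.quadraticTwist d).smul_smul_sub_eq_of_mem_inertia_geomPoints hmult hℓ hℓv hk h𝔓 hτ hQN
  -- `τ P = r(τ) P`, `τ Q = ± r(τ) Q`
  have hτP : τ • P = (((r τ : (ZMod (ℓ ^ k))ˣ) : ZMod (ℓ ^ k)).val : ℤ) • P := by
    rw [hr τ, natCast_zsmul]
  set τA : (W.quadraticTwist d).geomPoints →+ (W.quadraticTwist d).geomPoints :=
    DistribSMul.toAddMonoidHom _ τ with hτA
  have hτA' : ∀ R, τA R = τ • R := fun R ↦ rfl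
  obtain ⟨s, hs, hsr⟩ : ∃ s : ℤ, τ • Q = s • Q ∧
      (((s : ℤ) : ZMod (ℓ ^ k)) = ((r τ : (ZMod (ℓ ^ k))ˣ) : ZMod (ℓ ^ k)) ∨
        ((s : ℤ) : ZMod (ℓ ^ k)) = -((r τ : (ZMod (ℓ ^ k))ˣ) : ZMod (ℓ ^ k))) := by
    rcases hf τ with hplus | hminus
    · refine ⟨(((r τ : (ZMod (ℓ ^ k))ˣ) : ZMod (ℓ ^ k)).val : ℤ), ?_, Or.inl (by simp)⟩
      apply f.injective
      rw [hplus, hfQ, hτP, map_zsmul, hfQ]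
    · refine ⟨-(((r τ : (ZMod (ℓ ^ k))ˣ) : ZMod (ℓ ^ k)).val : ℤ), ?_, Or.inr (by simp)⟩
      apply f.injective
      have h2 : f (τ • Q) = -(τ • P) := by rw [hminus, hfQ]
      rw [h2, hτP, map_zsmul, hfQ, neg_zsmul]
  -- U1k in place of `intCast_eq_one_of_unipotent`, then Z1
  have hdiv : (ℓ : ℤ) ^ halfCeil k ∣ s - 1 :=
    pow_halfCeil_dvd_sub_one_of_unipotent hℓ hQord τA (by rw [hτA']; exact hs)
      (by rw [hτA', hτA']; exact hunip)
  exact unitsMap_sq_eq_one_of_dvd_sub_one (r τ) hsr hdiv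



end Summit.ABC.ABC.Theorems.DefiniteRTControlPrime.CyclicCharacter
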